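import Literature.MathematicalPhysics.QuantumManyBody.DiluteBoseGasUpperBoundLocalization
import Literature.MathematicalPhysics.QuantumManyBody.BoseGasDiluteEnergyFloor
import Literature.MathematicalPhysics.QuantumManyBody.BoseGasSubcellCondensationDilute
import HarnessLib

/-!
# `BecUvTail` (stmt-AtomisticToContinuum-8823), line `Sketch` — registered stub `stub_kineticBudget`

Helper for the crux skeleton `Cruxes/BecUvTail/Lines/Sketch.lean` of route `BECInfraredBound`
(`AtomisticToContinuum/BoseEinsteinCondensation`): proves the registered stub `stub_kineticBudget` verbatim.
The a-priori KINETIC BUDGET of near-minimisers: for a repulsive finite-range `v` there are `C > 0`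
and a density cap `ρ₀ > 0` such that for `0 < ρ < ρ₀`, for all large `N`, with the slack
`δ = ρN > 0`, every Dirichlet trial state `Ψ` of `N` bosons in the box of side `L_N = (N/ρ)^{1/3}`
with `⟨Ψ, H_N Ψ⟩ ≤ E₀^D(N, L_N) + δ` has `∫ |∇Ψ|² ≤ C ρ N`. Pure energy bookkeeping:
`∫ |∇Ψ|² ≤ ⟨Ψ, H_N Ψ⟩` (`v ≥ 0`, definition of `energy`) `≤ E₀ + δ`, and the eventual linear upper
bound `E₀^D(N, L_N) ≤ C' ρ N` (`eventually_groundStateEnergy_le_linear`), which for positive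
scattering length `a` is Dyson's upper bound `E₀ ≤ 4πρa(1 + C''(ρa³)^{1/3})N` (LSSY 2005,
Thm. 2.2 (2.14)–(2.15); the tree's `eventually_groundStateEnergy_le_dyson`) with the cap
`ρ a³ ≤ 1`, and for `a = 0` is `E₀ = o(N)` (`e₀(ρ) = 0`, the tree's
`e0_eq_zero_of_scatteringLength_zero` and `exists_density_cap_tendsto_e0`).
-/

noncomputable section

open MeasureTheory Filter
open scoped ENNReal NNReal BigOperators

namespace Summit.AtomisticToContinuum.BoseEinsteinCondensation.Theorems.BecUvTail

open Literature.MathematicalPhysics.QuantumManyBody.BoseGas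

/-- The energy dominates the kinetic energy (`v ≥ 0`): `∫ |∇Ψ|² ≤ ⟨Ψ, H_N Ψ⟩`. [folklore] -/
private theorem lintegral_kineticDensity_le_energy {N : ℕ} {L : ℝ} (v : ℝ → ℝ≥0∞)
    (Ψ : TrialState N L) : ∫⁻ X, kineticDensity Ψ.ψ X ≤ energy v Ψ :=
  lintegral_mono fun _ => le_self_add

/-- **Eventual linear upper bound on the Dirichlet ground-state energy at small density**: for a
repulsive finite-range `v` there are `C > 0` and `ρ₀ > 0` such that for `0 < ρ < ρ₀`, eventually in
`N`, `E₀^D(N, (N/ρ)^{1/3}) ≤ C ρ N`. For scattering length `a > 0` this is Dyson's upper bound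
`4πρa(1 + C'(ρa³)^{1/3})N` below the cap `ρa³ ≤ 1` (constant `4πa(1 + C')`); for `a = 0` the
energy per particle tends to `e₀(ρ) = 0`, so eventually `E₀ ≤ ρ N`.
[cite: LSSY2005, Thm 2.2 (2.14)–(2.15)] -/
private theorem eventually_groundStateEnergy_le_linear {v : ℝ → ℝ≥0∞}
    (hv : IsRepulsiveFiniteRange v) :
    ∃ C : ℝ, 0 < C ∧ ∃ ρ₀ : ℝ, 0 < ρ₀ ∧ ∀ ρ : ℝ, 0 < ρ → ρ < ρ₀ →
      ∀ᶠ N : ℕ in atTop,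
        groundStateEnergy v N (sideLength ρ N) ≤ ENNReal.ofReal (C * ρ * N) := by
  rcases eq_or_ne (scatteringLength v) 0 with h0 | hne
  · -- zero scattering length: `E₀^D(N, L_N) = o(N)`; take `C = 1`
    obtain ⟨ρ₂, hρ₂, Hcap⟩ := exists_density_cap_tendsto_e0 v hv
    refine ⟨1, one_pos, ρ₂, hρ₂, fun ρ hρ hρlt => ?_⟩
    obtain ⟨-, hD, hP⟩ := Hcap ρ hρ hρlt
    have he0 := e0_eq_zero_of_scatteringLength_zero hv h0 hρ hP
    rw [he0] at hD
    have h := (tendsto_order.1 hD).2 (ENNReal.ofReal ρ) (by simpa using hρ)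
    filter_upwards [h, eventually_gt_atTop 0] with N hN hNpos
    rw [energyPerParticleDirichlet, ENNReal.div_lt_iff (Or.inl (by exact_mod_cast hNpos.ne'))
      (Or.inl (ENNReal.natCast_ne_top N))] at hN
    refine hN.le.trans (le_of_eq ?_)
    rw [one_mul, ENNReal.ofReal_mul hρ.le, ENNReal.ofReal_natCast]
  · -- positive scattering length: Dyson's upper bound below the cap `ρ a³ ≤ 1`
    have hpos : 0 < scatteringLength v := pos_iff_ne_zero.2 hne
    obtain ⟨R₀, hR₀⟩ := hv.2
    have hfin : scatteringLength v ≠ ⊤ := scatteringLength_ne_top_of_finiteRange hR₀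
    obtain ⟨C, ρ₁, hC, hρ₁, H⟩ := eventually_groundStateEnergy_le_dyson hR₀ hv.1 hfin hpos
    set a : ℝ := (scatteringLength v).toReal with ha
    have ha0 : 0 < a := ENNReal.toReal_pos hpos.ne' hfin
    refine ⟨4 * Real.pi * a * (1 + C), by positivity, min ρ₁ (1 / a ^ 3),
      lt_min hρ₁ (by positivity), fun ρ hρ hρlt => ?_⟩
    have hρ1 : ρ < ρ₁ := hρlt.trans_le (min_le_left _ _)
    have hρ2 : ρ * a ^ 3 ≤ 1 := by
      have h := hρlt.trans_le (min_le_right _ _)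
      rw [lt_div_iff₀ (by positivity)] at h
      exact h.le
    have hY : (ρ * a ^ 3) ^ ((1 : ℝ) / 3) ≤ 1 := Real.rpow_le_one (by positivity) hρ2 (by norm_num)
    filter_upwards [H ρ hρ hρ1] with N hN
    refine hN.trans (ENNReal.ofReal_le_ofReal ?_)
    calc 4 * Real.pi * ρ * a * (1 + C * (ρ * a ^ 3) ^ ((1 : ℝ) / 3)) * N
        ≤ 4 * Real.pi * ρ * a * (1 + C * 1) * N := by gcongr
      _ = 4 * Real.pi * a * (1 + C) * ρ * N := by ring

/-- **A-priori kinetic budget of near-minimisers.** For a repulsive finite-range `v` there are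
`C > 0` and `ρ₀ > 0` such that for all `0 < ρ < ρ₀`, for all large `N`, there is a slack `δ > 0`
(namely `δ = ρN`) such that every Dirichlet trial state `Ψ` of `N` bosons in the box of side
`L_N = (N/ρ)^{1/3}` with `⟨Ψ, H_N Ψ⟩ ≤ E₀^D(N, L_N) + δ` satisfies `∫ |∇Ψ|² ≤ C ρ N`.
Proof: `∫ |∇Ψ|² ≤ ⟨Ψ, H_N Ψ⟩ ≤ E₀ + δ ≤ C'ρN + ρN` by `v ≥ 0` and the eventual linear upper bound
`E₀^D(N, L_N) ≤ C'ρN` (Dyson's upper bound `4πρa(1 + C''(ρa³)^{1/3})N` for `a > 0`, `E₀ = o(N)` for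
`a = 0`); `C = C' + 1` (registered stub `stub_kineticBudget` of stmt-AtomisticToContinuum-8823,
verbatim). [cite: LSSY2005, Thm 2.2 (2.14)–(2.15)] -/
theorem stub_kineticBudget :
    ∀ v : ℝ → ENNReal, Literature.MathematicalPhysics.QuantumManyBody.BoseGas.IsRepulsiveFiniteRange v → ∃ C : ℝ, 0 < C ∧ ∃ ρ₀ : ℝ, 0 < ρ₀ ∧ ∀ ρ : ℝ, 0 < ρ → ρ < ρ₀ → ∀ᶠ N : ℕ in Filter.atTop, ∃ δ : ENNReal, 0 < δ ∧ ∀ Ψ : Literature.MathematicalPhysics.QuantumManyBody.BoseGas.TrialState N (Literature.MathematicalPhysics.QuantumManyBody.BoseGas.sideLength ρ N), Literature.MathematicalPhysics.QuantumManyBody.BoseGas.energy v Ψ ≤ Literature.MathematicalPhysics.QuantumManyBody.BoseGas.groundStateEnergy v N (Literature.MathematicalPhysics.QuantumManyBody.BoseGas.sideLength ρ N) + δ → (∫⁻ X, Literature.MathematicalPhysics.QuantumManyBody.BoseGas.kineticDensity Ψ.ψ X) ≤ ENNReal.ofReal (C * ρ * N) := by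
  intro v hv
  obtain ⟨C, hC, ρ₀, hρ₀, H⟩ := eventually_groundStateEnergy_le_linear hv
  refine ⟨C + 1, by positivity, ρ₀, hρ₀, fun ρ hρ hρlt => ?_⟩
  filter_upwards [H ρ hρ hρlt, eventually_gt_atTop 0] with N hN hNpos
  refine ⟨ENNReal.ofReal (ρ * N), ENNReal.ofReal_pos.2 (mul_pos hρ (Nat.cast_pos.2 hNpos)),
    fun Ψ hΨ => ?_⟩
  calc ∫⁻ X, kineticDensity Ψ.ψ X ≤ energy v Ψ := lintegral_kineticDensity_le_energy v Ψ
    _ ≤ groundStateEnergy v N (sideLength ρ N) + ENNReal.ofReal (ρ * N) := hΨ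
    _ ≤ ENNReal.ofReal (C * ρ * N) + ENNReal.ofReal (ρ * N) := add_le_add hN le_rfl
    _ = ENNReal.ofReal ((C + 1) * ρ * N) := by
        rw [← ENNReal.ofReal_add (by positivity) (by positivity)]
        congr 1
        ring

end Summit.AtomisticToContinuum.BoseEinsteinCondensation.Theorems.BecUvTail

end
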